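import Mathlib
import Literature.NumberTheory.Irrationality.Brown2016.DinnerParties
import HarnessLib

/-!
# ζ(5) search — Families: a fast sufficient test for Brown's convergence condition (two right ends ⇒ not a block)

HONEST FRAMING: systematic search; no irrationality claim unless certified.

Cell `pub-zeta5`, seat P2 (for `fam-brown9`: "a cheaper decision procedure … would" let the kernel certify convergence of the
771 `N = 10` plans).  Brown's window test `Brown2016.isCyclicBlock n S` [Brown2016, §1.5, §3.1] tries all `n` starting points
(`O(n·k²)` per window).  A set of residues is a cyclic block `{a, a+1, …, a+k−1}` only if it has a UNIQUE "right end" (an element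
`x` with `x + 1 ∉ S`), namely `a + k − 1` — so exhibiting TWO right ends with different residues certifies that a window is NOT a
block, in `O(k²)`:
* `isCyclicBlock_iff` — Prop reading of the Boolean test;
* `rightEnd_unique` — in a cyclic block, two right ends have the same residue;
* `twoEnds n S` (Bool) and `isCyclicBlock_false_of_twoEnds`;
* `fastConv n σ` (Bool: every window of size `2 ≤ k ≤ n − 2` has two right ends) and
  **`isConvergent_of_fastConv : fastConv n σ = true → isConvergent n σ = true`** — a SOUND (not claimed complete) sufficient test,
  about `n/2`× cheaper in the kernel.  Used in `Families/ConfigurationsTenConvergent.lean`.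
-/

namespace Summit.KontsevichZagierPeriods.Zeta5Search.Families.Configurations

open Literature.NumberTheory.Irrationality.Brown2016

/-- Prop reading of Brown's Boolean block test: `S` (mod `n`) is the set `{a, a+1, …, a+|S|−1} (mod n)` for some `a < n`. -/
theorem isCyclicBlock_iff (n : ℕ) (S : List ℕ) :
    isCyclicBlock n S = true ↔ ∃ a < n,
      (∀ j < S.length, (a + j) % n ∈ S.map (· % n)) ∧ (∀ x ∈ S, x % n ∈ (List.range S.length).map fun j => (a + j) % n) := by
  unfold isCyclicBlock
  simp only [List.any_eq_true, List.mem_range, Bool.and_eq_true, List.all_eq_true, List.contains_iff_mem]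

/-- In a cyclic block two "right ends" (elements whose successor residue is missing) have the same residue. -/
theorem rightEnd_unique {n : ℕ} {S : List ℕ} (hS : isCyclicBlock n S = true) {x y : ℕ} (hx : x ∈ S) (hy : y ∈ S)
    (hx1 : (x + 1) % n ∉ S.map (· % n)) (hy1 : (y + 1) % n ∉ S.map (· % n)) : x % n = y % n := by
  rw [isCyclicBlock_iff] at hS
  obtain ⟨a, -, hfwd, hbwd⟩ := hS
  -- both `x` and `y` sit at the last position `|S| - 1` of the block
  have key : ∀ z ∈ S, (z + 1) % n ∉ S.map (· % n) → z % n = (a + (S.length - 1)) % n := by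
    intro z hz hz1
    obtain ⟨j, hj, hjz⟩ := List.mem_map.1 (hbwd z hz)
    rw [List.mem_range] at hj
    -- hjz : (a + j) % n = z % n
    by_cases hlast : j + 1 < S.length
    · exfalso
      apply hz1
      have h1 := hfwd (j + 1) hlast
      have : (z + 1) % n = (a + (j + 1)) % n := by
        rw [← Nat.mod_add_mod, ← hjz, Nat.mod_add_mod, Nat.add_assoc]
      rw [this]
      exact h1
    · have : j = S.length - 1 := by omega
      rw [← hjz, this]
  rw [key x hx hx1, key y hy hy1]

/-- Boolean certificate "two right ends with different residues". -/
def twoEnds (n : ℕ) (S : List ℕ) : Bool :=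
  let Sm := S.map (· % n)
  S.any fun x => S.any fun y =>
    !(x % n == y % n) && !(Sm.contains ((x + 1) % n)) && !(Sm.contains ((y + 1) % n))

/-- Two right ends ⇒ not a cyclic block. -/
theorem isCyclicBlock_false_of_twoEnds {n : ℕ} {S : List ℕ} (h : twoEnds n S = true) : isCyclicBlock n S = false := by
  rw [Bool.eq_false_iff]
  intro hS
  unfold twoEnds at h
  simp only [List.any_eq_true, Bool.and_eq_true, Bool.not_eq_true', beq_eq_false_iff_ne, ne_eq] at h
  obtain ⟨x, hx, y, hy, ⟨hxy, hx1⟩, hy1⟩ := h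
  have hx1' : (x + 1) % n ∉ S.map (· % n) := by
    intro hm; rw [List.contains_iff_mem.2 hm] at hx1; exact Bool.noConfusion hx1
  have hy1' : (y + 1) % n ∉ S.map (· % n) := by
    intro hm; rw [List.contains_iff_mem.2 hm] at hy1; exact Bool.noConfusion hy1
  exact hxy (rightEnd_unique hS hx hy hx1' hy1')

/-- Fast SUFFICIENT convergence test: every cyclic window of size `2 ≤ k ≤ n − 2` has two right ends. -/
def fastConv (n : ℕ) (σ : List ℕ) : Bool :=
  (List.range (n - 3)).all fun k' => (List.range n).all fun i => twoEnds n (window σ i (k' + 2))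

/-- **Soundness of the fast test**: `fastConv n σ = true → isConvergent n σ = true`. -/
theorem isConvergent_of_fastConv {n : ℕ} {σ : List ℕ} (h : fastConv n σ = true) : isConvergent n σ = true := by
  unfold fastConv at h
  unfold isConvergent
  rw [List.all_eq_true] at h ⊢
  intro k' hk'
  have hk := h k' hk'
  rw [List.all_eq_true] at hk ⊢
  intro i hi
  have := hk i hi
  rw [isCyclicBlock_false_of_twoEnds this]
  rfl

/-- Convergence of a seating plan from the fast test. [Brown2016, §1.5] -/
theorem isConvergent_of_fastConv' {n : ℕ} {σ : List ℕ} (h : fastConv n σ = true) : IsConvergent n σ :=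
  isConvergent_of_fastConv h

end Summit.KontsevichZagierPeriods.Zeta5Search.Families.Configurations
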